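import Literature.MathematicalPhysics.QuantumLattice.BdGBondHamiltonian
import Literature.MathematicalPhysics.QuantumLattice.MagneticHubbardTorusGauge
import Literature.MathematicalPhysics.QuantumLattice.PairFieldMomentum
import Literature.MathematicalPhysics.QuantumLattice.PairCorrelationsProofs
import Mathlib.Algebra.Order.Chebyshev
import Summits.HubbardSuperconductivity.HubbardSuperconductivity.Theorems.ThermalWedgeTwApproximatingHamiltonianLocality

/-!
# Route `KacWindowPenalty` — crux `WindowGap` (stmt-HubbardSuperconductivity-1088):
# the pair field seen from a Lieb–Schultz–Mattis-twisted state

Second step of the TWIST CEILING of `Cruxes/WindowGap/NOTES.md` §3/§8. Let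
`G_j = phaseGauge γ_j`, `γ_j(u) = twistGauge L (2πj) (toTorusSite u) = e^{−2πi j u₁/L}`, be the
Lieb–Schultz–Mattis twist of integer winding `j` on the fermionic torus `(ℤ/Lℤ)²`. Conjugating the
momentum-`m` pair field `Δ_f(m) = Σ_x conj χ_m(x) P^f_x` (`pairFieldAt f L m`) by `G_j`:

* `conjTranspose_phaseGauge_mul_annihilation_mul` — `G_γᴴ c_{xσ} G_γ = γ(x) c_{xσ}`, hence a
  product of two annihilators picks up `γ(x)γ(y)` (`conjTranspose_phaseGauge_mul_annMul_mul`);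
* `coe_twistGauge_ofTorusSite` — the twist phase IS a conjugate torus character,
  `γ_j(x) = conj χ_{j ê₁}(x)`;
* `conjTranspose_twist_mul_pairFieldAt_single_mul` — for a SINGLE-BOND form factor
  `Pi.single e (f e)` the bond `(x, x+e)` picks up `conj χ_{jê₁}(x)² · conj χ_{jê₁}(e)
  = conj χ_{2jê₁}(x) · u_e`, so `G_jᴴ Δ_{f_e}(m) G_j = u_e • Δ_{f_e}(m + 2j ê₁)` with `|u_e| = 1`:
  the twist SHIFTS THE PAIR MOMENTUM BY `2j` quanta (a pair carries charge two), up to a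
  unimodular bond phase;
* `pairFieldAt_eq_sum_single` — `Δ_f(m) = Σ_{e ∈ {0} ∪ unitSteps} Δ_{f_e}(m)`;
* `re_star_pairFieldAt_mulVec_twist_le` — consequently, for every Fock vector `ψ`,
  `‖Δ_f(m) (G_j ψ)‖² ≤ 5 · Σ_e ‖Δ_{f_e}(m + 2j ê₁) ψ‖²`
  (unitarity of `G_j`, Cauchy–Schwarz over the five bond types).

Summed over a momentum window and averaged over `j`, the right-hand side is controlled by the
per-bond Parseval sum rule — that is step 3 (file `…TwistCeiling`). Support for the crux
(`--supports stmt-HubbardSuperconductivity-1088`); no definitions (single-bond form factors are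
Mathlib's `Pi.single`), no named facts. H. Watanabe, J. Stat. Phys. 177 (2019) 717, §2.2.1;
T. Koma, H. Tasaki, PRL 68 (1992) 3248, eqs. (5)–(8); D. J. Scalapino, Phys. Rep. 250 (1995) 329, §2.
-/

-- the mandated namespace `Summit.<Summit>.<Problem>.Theorems` repeats `HubbardSuperconductivity`
-- (single-problem summit, D-0017), which the `dupNamespace` linter flags on every declaration
set_option linter.dupNamespace false

noncomputable section

namespace Summit.HubbardSuperconductivity.HubbardSuperconductivity.Theorems

open Matrix Finset Literature.MathematicalPhysics.QuantumLattice
  Literature.MathematicalPhysics.QuantumFieldTheory Literature.Probability.LatticeModels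
open scoped ComplexConjugate

/-! ### Site-phase conjugation of annihilation operators, `Gᴴ · G` form -/

section Gauge

variable {Λ : Type*} [LinearOrder Λ] [Fintype Λ]

/-- **`W_γᴴ c_{xσ} W_γ = γ(x) c_{xσ}`** for the site-phase unitary `W_γ = phaseGauge γ` (the tree's
`phaseGauge_mul_annihilation_mul_conjTranspose` read from the other side, `W_γᴴ = W_{γ⁻¹}`).
Koma–Tasaki, PRL 68 (1992) 3248, eqs. (7)–(8). [folklore] -/
theorem conjTranspose_phaseGauge_mul_annihilation_mul (γ : Λ → Circle) (x : Λ) (σ : Fin 2) :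
    (phaseGauge γ)ᴴ * annihilation (orb x σ) * phaseGauge γ = ((γ x : Circle) : ℂ) • annihilation (orb x σ) := by
  have h := phaseGauge_mul_annihilation_mul_conjTranspose γ⁻¹ x σ
  rw [phaseGauge_conjTranspose, inv_inv] at h
  rw [phaseGauge_conjTranspose, h, Pi.inv_apply, Circle.coe_inv_eq_conj, Complex.conj_conj]

/-- **A product of two annihilators picks up the product of the two site phases**:
`W_γᴴ (c_{xσ} c_{yτ}) W_γ = γ(x)γ(y) · c_{xσ} c_{yτ}`. [folklore] -/
theorem conjTranspose_phaseGauge_mul_annMul_mul (γ : Λ → Circle) (x y : Λ) (σ τ : Fin 2) :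
    (phaseGauge γ)ᴴ * (annihilation (orb x σ) * annihilation (orb y τ)) * phaseGauge γ =
      (((γ x : Circle) : ℂ) * ((γ y : Circle) : ℂ)) • (annihilation (orb x σ) * annihilation (orb y τ)) := by
  have h1 := conjTranspose_phaseGauge_mul_annihilation_mul γ x σ
  have h2 := conjTranspose_phaseGauge_mul_annihilation_mul γ y τ
  have hGG : phaseGauge γ * (phaseGauge γ)ᴴ = 1 := phaseGauge_mul_conjTranspose_self γ
  calc (phaseGauge γ)ᴴ * (annihilation (orb x σ) * annihilation (orb y τ)) * phaseGauge γ
      = (phaseGauge γ)ᴴ * annihilation (orb x σ) * (phaseGauge γ * (phaseGauge γ)ᴴ) *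
          annihilation (orb y τ) * phaseGauge γ := by
        rw [hGG]; noncomm_ring
    _ = ((phaseGauge γ)ᴴ * annihilation (orb x σ) * phaseGauge γ) *
          ((phaseGauge γ)ᴴ * annihilation (orb y τ) * phaseGauge γ) := by noncomm_ring
    _ = _ := by rw [h1, h2, smul_mul_smul_comm]

/-- **Site-phase conjugation of a local pair operator, bond by bond.** For any real form factor
`f'` and site `x` of the torus,
`W_γᴴ P^{f'}_x W_γ = Σ_{e ∈ {0} ∪ unitSteps} (f' e/√2) · γ(x)γ(x+e) · (c_{x↑}c_{x+e,↓} − c_{x↓}c_{x+e,↑})`.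
Scalapino, Phys. Rep. 250 (1995) 329, §2; Koma–Tasaki (1992) eqs. (7)–(8). [folklore] -/
theorem conjTranspose_phaseGauge_mul_localPair_mul {L : ℕ} [NeZero L]
    (γ : FermionTorus 2 L → Circle) (f' : Site 2 → ℝ) (x : TorusSite 2 L) :
    (phaseGauge γ)ᴴ * localPair f' L x * phaseGauge γ =
      ∑ e ∈ insert 0 unitSteps, ((f' e / Real.sqrt 2 : ℝ) : ℂ) •
        ((((γ (FermionTorus.ofTorusSite x) : Circle) : ℂ) *
            ((γ (FermionTorus.ofTorusSite (x + Torus.proj L e)) : Circle) : ℂ)) •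
          (annihilation (orb (FermionTorus.ofTorusSite x) 0) *
              annihilation (orb (FermionTorus.ofTorusSite (x + Torus.proj L e)) 1) -
            annihilation (orb (FermionTorus.ofTorusSite x) 1) *
              annihilation (orb (FermionTorus.ofTorusSite (x + Torus.proj L e)) 0))) := by
  unfold localPair
  rw [Finset.mul_sum, Finset.sum_mul]
  refine Finset.sum_congr rfl fun e _ => ?_
  rw [Matrix.mul_smul, Matrix.smul_mul, Matrix.mul_sub, Matrix.sub_mul,
    conjTranspose_phaseGauge_mul_annMul_mul, conjTranspose_phaseGauge_mul_annMul_mul, ← smul_sub]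

/-- `W_γᴴ (W_γ v) = v` (unitarity, vector form). [folklore] -/
theorem conjTranspose_phaseGauge_mulVec_phaseGauge_mulVec (γ : Λ → Circle) (v : Fock (Orb Λ)) :
    (phaseGauge γ)ᴴ *ᵥ (phaseGauge γ *ᵥ v) = v := by
  rw [mulVec_mulVec, conjTranspose_phaseGauge_mul_self, one_mulVec]

/-- `A (W_γ v) = W_γ ((W_γᴴ A W_γ) v)`: acting on a gauge-transformed vector is acting with the
conjugated operator, then transforming (`W_γ W_γᴴ = 1`). [folklore] -/
theorem mulVec_phaseGauge_mulVec (γ : Λ → Circle) (A : Matrix (Finset (Orb Λ)) (Finset (Orb Λ)) ℂ)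
    (v : Fock (Orb Λ)) :
    A *ᵥ (phaseGauge γ *ᵥ v) = phaseGauge γ *ᵥ (((phaseGauge γ)ᴴ * A * phaseGauge γ) *ᵥ v) := by
  rw [mulVec_mulVec, mulVec_mulVec, ← Matrix.mul_assoc, ← Matrix.mul_assoc,
    phaseGauge_mul_conjTranspose_self, Matrix.one_mul]

end Gauge

/-! ### The twist phase as a torus character -/

section Twist

variable {L : ℕ} [NeZero L]

/-- **The Lieb–Schultz–Mattis twist phase is a conjugate character**: for integer winding `j`,
`twistGauge L (2πj) x = e^{−2πi j x₁/L} = conj χ_{j ê₁}(x)` as complex numbers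
(`χ_k(x) = Π_i e^{2πi k_i x_i/L}`, `torusChar`). Watanabe (2019) §2.2.1. [folklore] -/
theorem coe_twistGauge_int (j : ℤ) (x : TorusSite 2 L) :
    ((twistGauge L (j * (2 * Real.pi)) x : Circle) : ℂ) =
      conj (torusChar (Pi.single 0 ((j : ℤ) : ZMod L) : TorusSite 2 L) x) := by
  -- the character at `k = j ê₁` is `stdAddChar (j * x 0) = (toCircle (x 0)) ^ j`
  have hchar : torusChar (Pi.single 0 ((j : ℤ) : ZMod L) : TorusSite 2 L) x =
      (ZMod.stdAddChar (x 0) : ℂ) ^ j := by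
    rw [torusChar, Fin.prod_univ_two, Pi.single_eq_same, Pi.single_eq_of_ne (by decide), zero_mul,
      AddChar.map_zero_eq_one, mul_one, ← zsmul_eq_mul, AddChar.map_zsmul_eq_zpow]
  rw [hchar, ZMod.stdAddChar_apply, ZMod.toCircle_apply, twistGauge, Circle.coe_exp, ← Complex.exp_int_mul,
    ← Complex.exp_conj]
  congr 1
  simp only [map_mul, map_div₀, map_ofNat, Complex.conj_ofReal, Complex.conj_I, map_natCast,
    map_intCast]
  push_cast
  ring

/-- The twist phase on the fermionic torus site attached to `x : (ℤ/Lℤ)²`. [folklore] -/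
theorem coe_twistGauge_ofTorusSite (j : ℤ) (x : TorusSite 2 L) :
    ((twistGauge L (j * (2 * Real.pi)) (FermionTorus.ofTorusSite x).toTorusSite : Circle) : ℂ) =
      conj (torusChar (Pi.single 0 ((j : ℤ) : ZMod L) : TorusSite 2 L) x) := by
  rw [FermionTorus.toTorusSite_ofTorusSite, coe_twistGauge_int]

/-- `conj χ_{k + k'}(x) = conj χ_k(x) · conj χ_{k'}(x)`: products of the conjugate characters that
multiply the twisted pair field (additivity in the momentum label, `torusChar_add_right` after
`torusChar_comm`; cf. `ffc_torusChar_add_left` of route FunctionFieldCertificate). [folklore] -/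
theorem conj_torusChar_add_left (k k' x : TorusSite 2 L) :
    conj (torusChar (k + k') x) = conj (torusChar k x) * conj (torusChar k' x) := by
  rw [torusChar_comm, torusChar_add_right, torusChar_comm x k, torusChar_comm x k', map_mul]

omit [NeZero L] in
/-- `j ê₁ + j ê₁ = (2j) ê₁` in `(ℤ/Lℤ)²`. [folklore] -/
theorem single_intCast_add_self (j : ℤ) :
    (Pi.single 0 ((j : ℤ) : ZMod L) : TorusSite 2 L) + Pi.single 0 ((j : ℤ) : ZMod L) =
      Pi.single 0 (((2 * j : ℤ)) : ZMod L) := by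
  rw [← Pi.single_add, ← Int.cast_add, ← two_mul]

/-- **The bond phase of the twisted pair field.** For the twist `γ_j = twistGauge L (2πj) ∘ toTorusSite`
and a bond `(x, x + e)`:
`γ_j(x) γ_j(x+e) = conj χ_{2jê₁}(x) · conj χ_{jê₁}(e)` — the site-dependent part is the conjugate
character at momentum `2j ê₁`, the rest a unimodular constant depending on the bond type only.
[folklore] -/
theorem twist_bondPhase (j : ℤ) (x : TorusSite 2 L) (e : Site 2) :
    ((twistGauge L (j * (2 * Real.pi)) (FermionTorus.ofTorusSite x).toTorusSite : Circle) : ℂ) *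
        ((twistGauge L (j * (2 * Real.pi))
          (FermionTorus.ofTorusSite (x + Torus.proj L e)).toTorusSite : Circle) : ℂ) =
      conj (torusChar (Pi.single 0 (((2 * j : ℤ)) : ZMod L) : TorusSite 2 L) x) *
        conj (torusChar (Pi.single 0 ((j : ℤ) : ZMod L) : TorusSite 2 L) (Torus.proj L e)) := by
  rw [coe_twistGauge_ofTorusSite, coe_twistGauge_ofTorusSite, torusChar_add_right,
    ← single_intCast_add_self, conj_torusChar_add_left]
  simp only [map_mul]
  ring

/-! ### The twisted single-bond pair field is a momentum-shifted pair field -/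

/-- A single-bond form factor selects one bond: for `e ∈ {0} ∪ unitSteps`,
`P^{f·1_e}_x = (f e/√2) · (c_{x↑}c_{x+e,↓} − c_{x↓}c_{x+e,↑})`. [folklore] -/
theorem localPair_single (f : Site 2 → ℝ) {e : Site 2} (he : e ∈ insert (0 : Site 2) unitSteps)
    (x : TorusSite 2 L) :
    localPair (Pi.single e (f e)) L x =
      ((f e / Real.sqrt 2 : ℝ) : ℂ) •
        (annihilation (orb (FermionTorus.ofTorusSite x) 0) *
            annihilation (orb (FermionTorus.ofTorusSite (x + Torus.proj L e)) 1) -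
          annihilation (orb (FermionTorus.ofTorusSite x) 1) *
            annihilation (orb (FermionTorus.ofTorusSite (x + Torus.proj L e)) 0)) := by
  unfold localPair
  rw [← Finset.sum_erase_add _ _ he, Pi.single_eq_same, Finset.sum_eq_zero, zero_add]
  intro e' he'
  rw [Pi.single_eq_of_ne (Finset.ne_of_mem_erase he'), zero_div, Complex.ofReal_zero, zero_smul]

/-- **Twisting a single-bond pair field shifts its momentum by `2j` quanta**: for
`e ∈ {0} ∪ unitSteps`, the Lieb–Schultz–Mattis twist `G_j` of winding `j` satisfies
`G_jᴴ Δ_{f·1_e}(m) G_j = conj χ_{jê₁}(e) • Δ_{f·1_e}(m + 2j ê₁)`. A pair carries charge two, so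
its momentum moves twice as fast as a single particle's under the twist; the bond orientation
contributes only the constant unimodular phase `conj χ_{jê₁}(e)`.
Watanabe, J. Stat. Phys. 177 (2019) 717, §2.2.1; Scalapino, Phys. Rep. 250 (1995) 329, §2. [folklore] -/
theorem conjTranspose_twist_mul_pairFieldAt_single_mul (f : Site 2 → ℝ) {e : Site 2}
    (he : e ∈ insert (0 : Site 2) unitSteps) (j : ℤ) (m : TorusSite 2 L) :
    (phaseGauge fun u : FermionTorus 2 L => twistGauge L (j * (2 * Real.pi)) u.toTorusSite)ᴴ *
        pairFieldAt (Pi.single e (f e)) L m *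
        phaseGauge (fun u : FermionTorus 2 L => twistGauge L (j * (2 * Real.pi)) u.toTorusSite) =
      conj (torusChar (Pi.single 0 ((j : ℤ) : ZMod L) : TorusSite 2 L) (Torus.proj L e)) •
        pairFieldAt (Pi.single e (f e)) L (m + Pi.single 0 (((2 * j : ℤ)) : ZMod L)) := by
  rw [pairFieldAt_eq_sum_torusChar, pairFieldAt_eq_sum_torusChar, Finset.mul_sum, Finset.sum_mul,
    Finset.smul_sum]
  refine Finset.sum_congr rfl fun x _ => ?_
  have hzero : ∑ e' ∈ (insert (0 : Site 2) unitSteps).erase e,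
      (((Pi.single e (f e) : Site 2 → ℝ) e' / Real.sqrt 2 : ℝ) : ℂ) •
        ((((twistGauge L (j * (2 * Real.pi)) (FermionTorus.ofTorusSite x).toTorusSite : Circle) : ℂ) *
            ((twistGauge L (j * (2 * Real.pi))
              (FermionTorus.ofTorusSite (x + Torus.proj L e')).toTorusSite : Circle) : ℂ)) •
          (annihilation (orb (FermionTorus.ofTorusSite x) 0) *
              annihilation (orb (FermionTorus.ofTorusSite (x + Torus.proj L e')) 1) -
            annihilation (orb (FermionTorus.ofTorusSite x) 1) *
              annihilation (orb (FermionTorus.ofTorusSite (x + Torus.proj L e')) 0))) = 0 := by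
    refine Finset.sum_eq_zero fun e' he' => ?_
    rw [Pi.single_eq_of_ne (Finset.ne_of_mem_erase he'), zero_div, Complex.ofReal_zero, zero_smul]
  rw [Matrix.mul_smul, Matrix.smul_mul, conjTranspose_phaseGauge_mul_localPair_mul,
    ← Finset.sum_erase_add _ _ he, hzero, zero_add, Pi.single_eq_same, twist_bondPhase,
    localPair_single f he]
  simp only [smul_smul, conj_torusChar_add_left]
  congr 1
  ring

/-- **The pair field is the sum of its single-bond pieces**: `Δ_f(m) = Σ_{e ∈ {0} ∪ unitSteps}
Δ_{f·1_e}(m)`. [folklore] -/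
theorem pairFieldAt_eq_sum_single (f : Site 2 → ℝ) (m : TorusSite 2 L) :
    pairFieldAt f L m = ∑ e ∈ insert (0 : Site 2) unitSteps, pairFieldAt (Pi.single e (f e)) L m := by
  have hloc : ∀ x : TorusSite 2 L,
      localPair f L x = ∑ e ∈ insert (0 : Site 2) unitSteps, localPair (Pi.single e (f e)) L x := by
    intro x
    conv_lhs => unfold localPair
    refine Finset.sum_congr rfl fun e he => ?_
    rw [localPair_single f he]
  simp_rw [pairFieldAt_eq_sum_torusChar, hloc, Finset.smul_sum]
  rw [Finset.sum_comm]

/-! ### Norm bound for the pair field of a twisted state -/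

/-- `‖Σ_{i ∈ s} v_i‖² ≤ #s · Σ_{i ∈ s} ‖v_i‖²` in a normed group (triangle inequality and
Cauchy–Schwarz / Chebyshev `sq_sum_le_card_mul_sum_sq`). [folklore] -/
theorem norm_sum_sq_le_card_mul {ι E : Type*} [SeminormedAddCommGroup E] (s : Finset ι) (v : ι → E) :
    ‖∑ i ∈ s, v i‖ ^ 2 ≤ s.card * ∑ i ∈ s, ‖v i‖ ^ 2 :=
  (pow_le_pow_left₀ (norm_nonneg _) (norm_sum_le s v) 2).trans (sq_sum_le_card_mul_sum_sq)

/-- **The pair field of a twisted state.** For every real form factor `f`, winding `j : ℤ`,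
momentum label `m` and Fock vector `ψ`, with `G_j` the Lieb–Schultz–Mattis twist
`phaseGauge (twistGauge L (2πj) ∘ toTorusSite)`:
`‖Δ_f(m) (G_j ψ)‖² ≤ 5 · Σ_{e ∈ {0} ∪ unitSteps} ‖Δ_{f·1_e}(m + 2j ê₁) ψ‖²`
(in the tree's `Re ⟨v, v⟩` form). Proof: `Δ_f(m) G_j = G_j (G_jᴴ Δ_f(m) G_j)`, `G_j` is unitary,
`G_jᴴ Δ_f(m) G_j = Σ_e u_e Δ_{f·1_e}(m + 2jê₁)` with `|u_e| = 1`
(`conjTranspose_twist_mul_pairFieldAt_single_mul`, `pairFieldAt_eq_sum_single`), and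
`‖Σ_{e∈S} w_e‖² ≤ |S| Σ ‖w_e‖²` with `|S| ≤ 5` (`twAhm_card_steps_le`). Watanabe (2019) §2.2.1; Scalapino (1995) §2. [folklore] -/
theorem re_star_pairFieldAt_mulVec_twist_le (f : Site 2 → ℝ) (j : ℤ) (m : TorusSite 2 L)
    (ψ : Fock (Orb (FermionTorus 2 L))) :
    (star (pairFieldAt f L m *ᵥ
        (phaseGauge (fun u : FermionTorus 2 L => twistGauge L (j * (2 * Real.pi)) u.toTorusSite) *ᵥ ψ)) ⬝ᵥ
      (pairFieldAt f L m *ᵥ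
        (phaseGauge (fun u : FermionTorus 2 L => twistGauge L (j * (2 * Real.pi)) u.toTorusSite) *ᵥ ψ))).re ≤
      5 * ∑ e ∈ insert (0 : Site 2) unitSteps,
        (star (pairFieldAt (Pi.single e (f e)) L (m + Pi.single 0 (((2 * j : ℤ)) : ZMod L)) *ᵥ ψ) ⬝ᵥ
          (pairFieldAt (Pi.single e (f e)) L (m + Pi.single 0 (((2 * j : ℤ)) : ZMod L)) *ᵥ ψ)).re := by
  -- `Δ (G ψ) = G ((Gᴴ Δ G) ψ)` and `G` preserves norms
  rw [mulVec_phaseGauge_mulVec, star_mulVec_dotProduct_self_of_unitary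
    (conjTranspose_phaseGauge_mulVec_phaseGauge_mulVec
      (fun u : FermionTorus 2 L => twistGauge L (j * (2 * Real.pi)) u.toTorusSite))]
  -- the conjugated pair field, bond by bond
  have hconj : (phaseGauge (fun u : FermionTorus 2 L => twistGauge L (j * (2 * Real.pi)) u.toTorusSite))ᴴ *
        pairFieldAt f L m *
        phaseGauge (fun u : FermionTorus 2 L => twistGauge L (j * (2 * Real.pi)) u.toTorusSite) =
      ∑ e ∈ insert (0 : Site 2) unitSteps,
        conj (torusChar (Pi.single 0 ((j : ℤ) : ZMod L) : TorusSite 2 L) (Torus.proj L e)) •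
          pairFieldAt (Pi.single e (f e)) L (m + Pi.single 0 (((2 * j : ℤ)) : ZMod L)) := by
    rw [pairFieldAt_eq_sum_single f m, Finset.mul_sum, Finset.sum_mul]
    refine Finset.sum_congr rfl fun e he => ?_
    rw [conjTranspose_twist_mul_pairFieldAt_single_mul f he j m]
  rw [hconj, sum_mulVec, ← norm_toLp_sq_eq_re, WithLp.toLp_sum]
  refine (norm_sum_sq_le_card_mul _ _).trans ?_
  have h5 : ((insert (0 : Site 2) unitSteps).card : ℝ) ≤ 5 := by
    exact_mod_cast twAhm_card_steps_le
  have hterm : ∀ e ∈ insert (0 : Site 2) unitSteps,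
      ‖(WithLp.toLp 2 ((conj (torusChar (Pi.single 0 ((j : ℤ) : ZMod L) : TorusSite 2 L)
          (Torus.proj L e)) • pairFieldAt (Pi.single e (f e)) L
            (m + Pi.single 0 (((2 * j : ℤ)) : ZMod L))) *ᵥ ψ) :
            EuclideanSpace ℂ (Finset (Orb (FermionTorus 2 L))))‖ ^ 2 =
        (star (pairFieldAt (Pi.single e (f e)) L (m + Pi.single 0 (((2 * j : ℤ)) : ZMod L)) *ᵥ ψ) ⬝ᵥ
          (pairFieldAt (Pi.single e (f e)) L (m + Pi.single 0 (((2 * j : ℤ)) : ZMod L)) *ᵥ ψ)).re := by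
    intro e _
    rw [smul_mulVec, WithLp.toLp_smul, norm_smul, Complex.norm_conj, norm_torusChar, one_mul,
      norm_toLp_sq_eq_re]
  rw [Finset.sum_congr rfl hterm]
  have hnonneg : 0 ≤ ∑ e ∈ insert (0 : Site 2) unitSteps,
      (star (pairFieldAt (Pi.single e (f e)) L (m + Pi.single 0 (((2 * j : ℤ)) : ZMod L)) *ᵥ ψ) ⬝ᵥ
        (pairFieldAt (Pi.single e (f e)) L (m + Pi.single 0 (((2 * j : ℤ)) : ZMod L)) *ᵥ ψ)).re :=
    Finset.sum_nonneg fun e _ => by rw [← norm_toLp_sq_eq_re]; positivity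
  exact mul_le_mul_of_nonneg_right h5 hnonneg

end Twist

end Summit.HubbardSuperconductivity.HubbardSuperconductivity.Theorems
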